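import Literature.MathematicalPhysics.QuantumFieldTheory.Balaban1983to89.B1RG242
import Literature.MathematicalPhysics.QuantumFieldTheory.Balaban1983to89.TorusGeometry

/-!
# `Balaban1983to89.B1RG242Torus` — Bałaban's CONCRETE block-averaging tower on the tori T^{(j)} (scalar case U = 1): the hypotheses of `B1RG242` PROVED for it, hence B1 (2.43) = B4 (2.34) = B5 (1.135) "with □ replaced by the whole torus" UNCONDITIONALLY, kernel-checked

B1 = T. Bałaban, *(Higgs)₂,₃ quantum fields in a finite volume. I. A lower bound*, Commun. Math. Phys. **85**,
603–636 (1982) [Balaban1982Higgs1] (journal page = PDF page + 602); B4 = T. Bałaban, *Regularity and decay of lattice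
Green's functions*, Commun. Math. Phys. **89**, 571–597 (1983) [Balaban1983RegularityDecay] (journal page = PDF page
+ 570); B5 = T. Bałaban, *Propagators and renormalization transformations for lattice gauge theories. I*, Commun.
Math. Phys. **95**, 17–40 (1984) [Balaban1984PropagatorsI] (journal page = PDF page + 16); B12 = T. Bałaban,
*Renormalization group approach to lattice gauge field theories. I*, Commun. Math. Phys. **109**, 249–301 (1987)
[Balaban1987RG1] (the tori T^{(j)} of `Setup`/`TorusGeometry`).

CITATION HEADER (lean-in-tree rule 2026-08-18).  The sibling module `B1RG242` kernel-proves B1 (2.41)/(2.42)/(2.43)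
(p. 612, quoted there in full: *"… Using the identity G^ε_1(Ω,A) = C^{(0),ε}(Ω,A), we get G^ε_k(Ω,A) = Σ_{j=1}^{k−1}
a_j²(L^jε)^{−4}G^ε_j(Ω,A)Q^*_j(A)C^{(j),L^jε}(Ω,A)Q_j(A)G^ε_j(Ω,A) + C^{(0),ε}(Ω,A). (2.43)"*) for ABSTRACT data, with
QQ^* = 1, Q_{k+1} = QQ_k, Q^*_{k+1} = Q^*_kQ^*, adjointness for (1.5) and the existence of the inverses (2.20)/(2.30) as
HYPOTHESES (`B1RG242.Tower.Consistent`, `B1RG242.StepData.ScalarProducts`; its NOT-CERTIFIED item (iii): "never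
asserted for Bałaban's concrete operators, which are not constructed in this module").  THIS module CONSTRUCTS the
concrete operators in the scalar case U = 1 (B1 p. 608 [PDF 6]: *"The renormalization transformations for vector
fields will be obtained by taking N = d and an external vector field A = 0"*; B5's primed operators) on the tori
T^{(j)} = `Site P j` of `Setup`, and PROVES every one of those hypotheses for them.  The printed definitions typed here,
verbatim from the renders:
* B1 p. 604 [PDF 2], (1.4)–(1.5): *"The difference derivative is defined by the formula (∂^εf)(b) = ε^{−1}(f(b_+) − f(b_−)).
  (1.4) It is an operator on functions defined on a lattice into functions defined on bonds of this lattice. The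
  difference derivative in a given direction μ can be defined in an obvious way also. The adjoint operators with
  respect to the scalar product ⟨f,g⟩ = Σ_{x∈T_ε} ε^d f(x)·g(x) (1.5) can be easily written up."*
* B1 p. 605 [PDF 3], after (1.11): *"Here −Δ^ε_A = D^{ε*}_A D^ε_A is the covariant Laplace operator and −Δ^ε = ∂^{ε*}∂^ε is
  the Laplace operator on the torus T_ε."*; (1.8): the term ½Σ_{b⊂T_ε} ε^d|(D^ε_Aφ)(b)|² of the action, = ½⟨φ,(−Δ^ε_A)φ⟩
  in (1.11).
* B1 p. 606 [PDF 4], (1.17): *"A block B(y) of the lattice ηZ^d, y ∈ LηZ^d, is defined by B(y) = {x ∈ ηZ^d : y_μ ≤ x_μ <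
  y_μ + Lη, μ = 1, …, d}."*; p. 607 [PDF 5], (1.20)–(1.21): *"T^{(k)}_{L^kε} = B(T^{(k+1)}_{L^{k+1}ε}), k = 0, 1, …, thus
  T_ε = B^k(T^{(k)}_{L^kε}). (1.20) … For the functions defined on the points of the lattice ηZ^d or on the bonds of this
  lattice, a scalar product is defined as usual by the formula (1.5) with η instead of ε."*
* B1 p. 608 [PDF 6], (2.2) and (2.7): *"Let us denote by x_j a point of torus T^{(j)}_{L^jε}, such that x ∈ B^j(x_j). Of
  course x_k = y and x_j ∈ B(x_{j+1})."*; *"(Q(A)φ)(y) = L^{−d}Σ_{x∈B(y)} U(A(Γ_{y,x}))φ(x). (2.7)"*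
* B1 p. 609 [PDF 7], (2.11), (2.13): *"(Q_k(A)f)(y) = L^{−kd}Σ_{x∈B^k(y)} U(A(Γ^{(k)}_{y,x}))f(x), y ∈ T^{(k)}_{L^kε}. (2.11)
  … a_{k+1} = aa_k/(aL^{−2} + a_k). (2.13)"* (an initial condition a_1 = a; the tree's `B1.aSeq`).
* B1 p. 610 [PDF 8], (2.17), (2.20): *"Δ^{(0),ε}(Ω,A) = −Δ^{ε,N}_{A,Ω} + m², (2.17)"*; *"G^ε_k(Ω,A) = (−Δ^{ε,N}_{A,Ω} + m² +
  a_k(L^kε)^{−2}P_k(A))^{−1}, P_k(A) = Q^*_k(A)Q_k(A), (2.20)"*.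
* B1 p. 611 [PDF 9], (2.30): *"C^{(k),L^kε}(Ω,A) = (a(L^{k+1}ε)^{−2}P(A) + Δ^{(k),L^kε}(Ω,A))^{−1}. (2.30) … It is not
  clear from the formulas (2.30), (2.31) that the covariances are well defined. It is so, and it is one of the
  assertions of Proposition 2.3."*
* B4 p. 572 [PDF 2], (1.4)–(1.6): *"(Q_k(A)φ)(y) = Σ_{x∈B^k(y)} η^dU(A(Γ^{(k)}_{y,x}))φ(x), y ∈ Z^d. (1.4) … The projection
  operator P_k(A) is given by P_k(A) = Q^*_k(A)Q_k(A). (1.5) Our fundamental Green's function is a kernel of the operator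
  G_k(Ω,A) = (−Δ^{η,N}_{A,Ω} + m² + aP_k(A))^{−1}, (1.6) where m² ≥ 0 and a is a positive constant close to 1."*; p. 580
  [PDF 10]: *"The operator P_k is an orthogonal projection"*; p. 582 [PDF 12], in the proof of Lemma 2.2 (opened p. 581
  [PDF 11]; the reduction step immediately preceding the statement of Lemma 2.4): *"This proof is
  based on renormalization group equations (2.43) of [1] rescaled to the η-lattice: G_k(□) = C^{(0),η}(□) +
  Σ_{j=1}^{k−1} a_j²(L^jη)^{−4}G^η_j(□)Q^*_jC^{(j),L^jη}(□)Q_jG^η_j(□). (2.34)"*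
* B5 p. 20 [PDF 4], after (1.20): *"or denoting (Q′_kλ)(y) = Σ_{x∈B^k(y)} η^dλ(x)"* (the SCALAR k-fold block average,
  η = L^{−k}); p. 39 [PDF 23], proof of Prop. 1.2: *"We use Lemma 2.4 of that paper and the equality (2.34) with □
  replaced by the whole torus. Let us write this equality again, G′_k = C^{(0),η} + Σ_{j=1}^{k−1}
  a_j²(L^jη)^{−4}G′^η_jQ′*_jC^{(j),L^jη}Q′_jG′^η_j, (1.135)"* (G′_k = (Δ + aQ′*_kQ′_k)^{−1}, p. 25: MASSLESS — whence
  m² ≥ 0, not m² > 0, below).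

WHAT IS KERNEL-CHECKED HERE (over ℝ, on the tori T^{(j)} = `Site P j` = (ℤ/2L^{m+K−j})^d of `Setup`, B12 (0.1)):
 §1  the a-fold block maps T^{(i)} → T^{(i')}, x ↦ y with x ∈ B^a(y), as integer division of labels by L^a
     (`Site.proj`; = `blockOf` of `Setup` for a = 1), their composition B^{a+b} = B^b∘B^a (`Site.proj_comp`, the
     content of "x_j ∈ B(x_{j+1})", (2.2)), the bijective parametrisation of B^a(y) by offsets and |B^a(y)| = L^{ad}
     (`Site.fibreEquiv`, `Site.card_fibre`), and: a function on T^{(i)} invariant under all unit shifts is constant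
     (`Site.const_of_shift_invariant`);
 §3  the weighted averaging matrix (Qf)(y) = wΣ_{x∈B^a(y)} f(x) and the block-constant extension (Q^*g)(x) = g(y(x))
     (`avgMat`, `extMat`) with: QQ^* = wL^{ad}·1 (`avgMat_mul_extMat`), two-stage averaging/extension = one-stage
     (`avgMat_mul_avgMat`, `extMat_mul_extMat`), and ADJOINTNESS for the scalar products (1.5) with weights s^d (fine)
     and s'^d (coarse) exactly when s'^d·w = s^d (`adjoint_weight`) — "can be easily written up" (p. 604), written up;
 §4  −Δ^s + m² := m²·1 + Σ_μ (∂^s_μ)ᵀ∂^s_μ on a torus of spacing s with (∂^s_μf)(x) = s^{−1}(f(x + se_μ) − f(x)) (1.4)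
     (`deriv`, `hOp`, `deriv_mulVec`), the form identity Σ_x f·(−Δ^s + m²)f = m²Σf² + Σ_μΣ_x|∂_μf|² (`form_hOp`; (1.8) =
     (1.11), B4 (1.3), U = 1), positive semi-definiteness for m² ≥ 0 (`form_hOp_nonneg`), and THE KERNEL LEMMA
     (`eq_zero_of_ker`): (−Δ^s + m²)f = 0, m² ≥ 0, and one positively weighted block average of f vanishing ⟹ f = 0
     (∂_μf = 0 ∀μ ⟹ f constant on the torus ⟹ its block average is a positive multiple of the constant);
 §5  THE TOWER `tower P a msq : B1RG242.Tower ℝ (Site P 0)` — κ j := T^{(j)}; H := −Δ^ε + m² on T_ε (2.17 with A = 0,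
     Ω = T_ε); Q_j := L^{−jd}Σ_{B^j(y)} (2.11)/(B4 (1.4)); Q^*_j := block-constant extension; Q := L^{−d}Σ_{B(y)} on T^{(j)}
     (2.7); Q^*; α_j := a_j(L^jε)^{−2} (a_j = `B1.aSeq a L j`), β_j := a(L^{j+1}ε)^{−2} — and, for 0 < a and 0 ≤ m²:
       QQ^* = 1 and Q_jQ^*_j = 1 at every level                                  (`QQs`, `QkQks`; B4 p. 580),
       Q_{j+1} = QQ_j, Q^*_{j+1} = Q^*_jQ^*                                         (`Qk_succ`, `Qks_succ`; (2.12)/(2.14)),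
       `B1RG242.StepData.ScalarProducts` at every level j ≥ 1 for the weights ε^d, (L^jε)^d, (L^{j+1}ε)^d of (1.5)/(1.21)
         — positivity, ⟨φ,(−Δ^ε + m²)φ⟩ ≥ 0, Q^*_j and Q^* ARE the (1.5)-adjoints, α_j, β_j > 0   (`scalarProducts`),
       EXISTENCE of G^ε_j: −Δ^ε + m² + a_j(L^jε)^{−2}Q^*_jQ_j invertible, j ≥ 1       (`G_arg`, by the kernel lemma),
       α_{j+1} = α_jβ_j/(α_j + β_j), i.e. (2.13)                                    (`γ_eq`, via `B1RG242.StepData.γ_printed`),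
       EXISTENCE of C^{(j),L^jε}: a(L^{j+1}ε)^{−2}Q^*Q + Δ^{(j),L^jε} invertible, j ≥ 1 — the finite-torus, U = 1 content
         of "It is so" (p. 611)                                                 (`C_arg`, via `B1RG242.StepData.isUnit_C_of_next`),
       hence `B1RG242.Tower.Consistent` HOLDS                                      (`consistent`),
       hence (2.43) = B4 (2.34) = B5 (1.135) on the whole torus, for THESE operators, with no hypothesis left:
         G^ε_k = Σ_{j=1}^{k−1} a_j²(L^jε)^{−4}G^ε_jQ^*_jC^{(j),L^jε}Q_jG^ε_j + G^ε_1 (k ≥ 1), G^ε_1 = C^{(0),ε}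
                                                                                 (`display243`, `display234_unit`, `G_one`, `term_eq`);
     and the DICTIONARY LEMMAS certifying that the fields of `tower` ARE the printed operators in Bałaban's range of
     levels: (Q_jf)(y) = L^{−jd}Σ_{x∈B^j(y)}f(x) with |B^j(y)| = L^{jd} for j ≤ m + K (`Qk_mulVec`, `card_Bj`), Q on T^{(j)}
     has matrix L^{−d}·1_{x∈B(y)} with `blockOf`/`block` of `Setup` for j + 1 ≤ m + K (`Q_apply`, `Q_mulVec`),
     (Q^*_jg)(x) = g(y(x)), (Q^*ψ)(x) = ψ(blockOf x) (`Qks_mulVec`, `Qs_mulVec`), ⟨φ,(−Δ^ε + m²)φ⟩ = ε^d(m²Σφ² + Σ|∂^εφ|²)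
     (`form_H`, B4 (1.3)/B1 (1.8) with U = 1), (∂^ε_μf)(x) = ε^{−1}(f(x + εe_μ) − f(x)) (`deriv_mulVec`, (1.4)).
DICTIONARY (print ↦ Lean): T_ε, T^{(j)}_{L^jε} ↦ `Site P 0`, `Site P j`; x ∈ B^a(y) ↦ `Site.proj _ a x = y`; ⟨f,g⟩ of
(1.5) on T^{(j)} ↦ `f ⬝ᵥ (W P j *ᵥ g)` (`WE P` on T_ε); ∂^ε_μ ↦ `deriv P 0 P.eps μ`; −Δ^ε + m² ↦ `H P msq` = `hOp P 0
P.eps msq`; Q_j, Q^*_j (U = 1) ↦ `Qk P j`, `Qks P j`; Q, Q^* on T^{(j)} ↦ `Q P j`, `Qs P j`; a_j(L^jε)^{−2} ↦ `α P a j`;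
a(L^{j+1}ε)^{−2} ↦ `β P a j`; G^ε_j, C^{(j),L^jε}, the j-th term of (2.43) ↦ `(tower P a msq).G j`, `.C j`, `.term j`
(the `B1RG242.Tower` API); L^jε ↦ `P.spacing j`; ε = L^{−K} ↦ `P.eps`.

WHAT IS NOT CERTIFIED HERE, AND HOW IT IS LABELLED.  (i) The GAUGE-COVARIANT operators (U(A(Γ_{y,x})) ≠ 1 in
(2.7)/(2.11)/(B4 (1.4)), the covariant Laplacian −Δ^ε_A of (1.7)/(B4 (1.3))) are NOT constructed: only A = 0 (U = 1),
which is B1's own vector-field case (p. 608) and exactly B5's primed tower Q′_j of (1.135) (p. 20); for A ≠ 0 the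
module `B1RG242` with its hypotheses remains the typed statement.  (ii) Only the WHOLE TORUS: no subset Ω ⊂ T^{(k)}
with Neumann conditions (B1's Ω, B4's parallelepipeds □) — this is precisely the case B5 p. 39 invokes ("with □
replaced by the whole torus"), and the case for which nothing is printed in B4.  (iii) Nothing QUANTITATIVE: B1
Prop. 2.3 / (2.33) (uniform bounds γ₀, γ₁), B4 Lemma 2.4 (2.35)–(2.37), B5 (1.136)–(1.137) are untouched — `G_arg`,
`C_arg` are the qualitative finite-lattice existence statements only; the tree's `B5Ineq137.Display136` (the
identity read on KERNELS with each term rescaled to its unit lattice, B1 (1.22)) is NOT discharged here (no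
rescaling is performed: the identity is stated, as (2.43) is, for the ε-lattice operators).  (iv) The
Gaussian-integration dictionary behind (2.18)–(2.21)/(2.30) and the normalisation identities (2.39)/(2.40): as in
`B1RG242`, not typed.  (v) COMPLETION ARTEFACT (DIVERGENCE D-pv07.13): `B1RG242.Tower.Consistent` quantifies over
ALL j ≥ 1, whereas Bałaban's lattices stop at the unit lattice T^{(K)} (ε = L^{−K}) inside the finite family T^{(j)},
j ≤ m + K, of `Setup`; the levels j > m + K are completed by IDENTITY maps (realised exponent `lvl j = min j (m+K)`,
step exponent `stepExp j ∈ {0,1}`), disclosed by `Q_apply_of_le`; every dictionary lemma above carries the range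
hypothesis (j ≤ m + K, resp. j + 1 ≤ m + K) under which the typed operator is literally the printed one, and (2.43)
for k ≤ m + K involves only such levels (its top term j = k − 1 contains the step Q_{k−1} inside C^{(k−1)}, printed for
k ≤ m + K; v1 wrote "k ≤ m + K + 1" — corrected, XREAD remark N2 of C-pv27-23).  (vi) CONVENTIONS: B1's torus (1.2)
has 2ε^{−1}L_μ = 2L^KML′_μ sites per
direction, `Setup`'s T^{(j)} has 2L^{m+K−j} (B12 (0.1): ML′_μ ↦ L^m, all directions equal) — a sub-family; B1's blocks
(1.17) are corner-anchored in coordinates while B12's are centred cubes (DIVERGENCE F3 of `Setup`), but in integer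
labels counted from the corner of the torus both are n ↦ ⌊n/L⌋ = `blockOf`, so the operator algebra typed here is
convention-independent.  (vii) The (1.5)-adjoint of the site→bond derivative is typed as the TRANSPOSE (equal weights
ε^d on sites and bonds, (1.8)/(1.21)) — [folklore dictionary]; −Δ^ε := Σ_μ ∂ᵀ_μ∂_μ is then "∂^{ε*}∂^ε" (p. 605).
CELL BOOK-KEEPING (pub-balaban).  Discharges `B1RG242` NOT-CERTIFIED (iii) and GAPS G-pv07-2 (a) at the level of
Bałaban's ACTUAL operators for U = 1 on the torus (the B5 p. 39 use), m² ≥ 0 (so B5's massless G′ is covered);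
certification row C-pv07-15; DIVERGENCE D-pv07.13 (completion levels; m² ≥ 0 chosen over `consistent_of_posDef`'s
m² > 0 because B4 (1.6) prints "m² ≥ 0" and B5's G′_k is massless — the kernel lemma replaces positive definiteness).
VALUE = kernel certificate (the hypotheses of a located "easy calculations"/"It is so" passage become theorems for
the concrete scalar operators), NOT summit progress.
-/

namespace Literature.MathematicalPhysics.QuantumFieldTheory.Balaban1983to89

open Matrix

noncomputable section

/-! ## §1  Multi-level block maps T^{(i)} → T^{(i')} on the tori of `Setup` -/

namespace Site

variable {P : Params} {i i' i'' : ℕ}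

/-- The `a`-fold block map T^{(i)} → T^{(i')}, x ↦ the y with x ∈ B^a(y): integer label n ↦ ⌊n/L^a⌋ coordinatewise
(B1 (1.17): B(y) = {x : y_μ ≤ x_μ < y_μ + Lη}, iterated a times, (1.20); B12 (0.3): B^k(y) = the L^{kd} points of the
finer lattice in the cube over y).  Meaningful when `sitesPerDir i = L^a · sitesPerDir i'`; for a = 1, i' = i + 1 it
is `blockOf` of `Setup` (`proj_one_eq_blockOf`). [cite: Balaban1982Higgs1, (1.17) p.606, (1.20) p.607] -/
def proj (i' a : ℕ) (x : Site P i) : Site P i' :=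
  fun μ => (((x μ).val / P.L ^ a : ℕ) : ZMod (P.sitesPerDir i'))

/-- The label of `proj i' a x` is n / L^a (no wrap-around when the site counts match). [folklore] -/
theorem val_proj {a : ℕ} (h : P.sitesPerDir i = P.L ^ a * P.sitesPerDir i') (x : Site P i) (μ : Fin P.d) :
    ((proj i' a x) μ).val = (x μ).val / P.L ^ a := by
  simp only [proj]
  rw [ZMod.val_natCast, Nat.mod_eq_of_lt]
  rw [Nat.div_lt_iff_lt_mul (pow_pos P.L_pos a), mul_comm, ← h]
  exact ZMod.val_lt (x μ)

/-- Block maps compose: ⌊⌊n/L^a⌋/L^b⌋ = ⌊n/L^{a+b}⌋ (B1 (2.2)/(2.12): Γ^{(k+1)}_{z,x} = Γ^{(k)}_{y,x} ∪ Γ^{L^kη}_{z,y}, i.e.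
B^{k+1}(z) = ⋃_{y ∈ B(z)} B^k(y)). [cite: Balaban1982Higgs1, (2.12) p.609] -/
theorem proj_comp {a b : ℕ} (h : P.sitesPerDir i = P.L ^ a * P.sitesPerDir i')
    (h' : P.sitesPerDir i' = P.L ^ b * P.sitesPerDir i'') (x : Site P i) :
    proj i'' b (proj i' a x) = proj i'' (a + b) x := by
  have h'' : P.sitesPerDir i = P.L ^ (a + b) * P.sitesPerDir i'' := by rw [h, h', pow_add, mul_assoc]
  funext μ
  apply ZMod.val_injective
  rw [val_proj h', val_proj h, val_proj h'', Nat.div_div_eq_div_mul, pow_add]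

/-- For one level the block map is `blockOf` of `Setup`. [cite: Balaban1987RG1, (0.3) p.252] -/
theorem proj_one_eq_blockOf (x : Site P i) : proj (i + 1) 1 x = blockOf x := by
  funext μ; simp only [proj, blockOf, pow_one]

/-- The zero-fold block map is the identity. [folklore] -/
theorem proj_zero (x : Site P i) : proj i 0 x = x := by
  funext μ; simp only [proj, pow_zero, Nat.div_one, ZMod.natCast_val, ZMod.cast_id', id_eq]

/-- The fine site over `y` with offset r ∈ {0,…,L^a − 1}^d from the lowest label nL^a of B^a(y). [folklore] -/
def fibreSite (i : ℕ) {i' : ℕ} (a : ℕ) (y : Site P i') (r : Fin P.d → Fin (P.L ^ a)) : Site P i :=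
  fun μ => (((y μ).val * P.L ^ a + r μ : ℕ) : ZMod (P.sitesPerDir i))

/-- Label of `fibreSite i a y r` is nL^a + r (no wrap-around). [folklore] -/
theorem val_fibreSite {a : ℕ} (h : P.sitesPerDir i = P.L ^ a * P.sitesPerDir i') (y : Site P i')
    (r : Fin P.d → Fin (P.L ^ a)) (μ : Fin P.d) :
    ((fibreSite i a y r) μ).val = (y μ).val * P.L ^ a + r μ := by
  simp only [fibreSite]
  rw [ZMod.val_natCast, Nat.mod_eq_of_lt]
  have hy : (y μ).val + 1 ≤ P.sitesPerDir i' := ZMod.val_lt (y μ)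
  have h1 : ((y μ).val + 1) * P.L ^ a ≤ P.sitesPerDir i' * P.L ^ a := Nat.mul_le_mul_right _ hy
  have h2 := (r μ).isLt
  rw [h, mul_comm (P.L ^ a)]
  rw [Nat.add_mul, one_mul] at h1
  omega

/-- `fibreSite i a y r ∈ B^a(y)`. [folklore] -/
theorem proj_fibreSite {a : ℕ} (h : P.sitesPerDir i = P.L ^ a * P.sitesPerDir i') (y : Site P i')
    (r : Fin P.d → Fin (P.L ^ a)) : proj i' a (fibreSite i a y r) = y := by
  funext μ
  apply ZMod.val_injective
  rw [val_proj h, val_fibreSite h, mul_comm, Nat.mul_add_div (pow_pos P.L_pos a), Nat.div_eq_of_lt (r μ).isLt,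
    add_zero]

/-- B^a(y) is parametrised bijectively by the offsets {0,…,L^a − 1}^d (generalises `blockEquiv`, a = 1). [folklore] -/
def fibreEquiv {a : ℕ} (h : P.sitesPerDir i = P.L ^ a * P.sitesPerDir i') (y : Site P i') :
    {x : Site P i // proj i' a x = y} ≃ (Fin P.d → Fin (P.L ^ a)) where
  toFun x := fun μ => ⟨(x.1 μ).val % P.L ^ a, Nat.mod_lt _ (pow_pos P.L_pos a)⟩
  invFun r := ⟨fibreSite i a y r, proj_fibreSite h y r⟩
  left_inv x := by
    obtain ⟨x, hx⟩ := x
    apply Subtype.ext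
    funext μ
    apply ZMod.val_injective
    show ((fibreSite i a y fun μ => ⟨(x μ).val % P.L ^ a, Nat.mod_lt _ (pow_pos P.L_pos a)⟩) μ).val = (x μ).val
    rw [val_fibreSite h]
    have h1 : (x μ).val / P.L ^ a = (y μ).val := by rw [← val_proj h x μ, hx]
    have h2 := Nat.div_add_mod ((x μ).val) (P.L ^ a)
    rw [h1] at h2
    simp only
    linarith [h2, mul_comm ((y μ).val) (P.L ^ a)]
  right_inv r := by
    funext μ
    apply Fin.ext
    show ((fibreSite i a y r) μ).val % P.L ^ a = (r μ : ℕ)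
    rw [val_fibreSite h, Nat.mul_add_mod', Nat.mod_eq_of_lt (r μ).isLt]

/-- |B^a(y)| = L^{ad} (B12 (0.3): "the L^{kd} points of the finer lattice"; B1 (2.11): B^k(y)). [cite: Balaban1987RG1, (0.3) p.252] -/
theorem card_fibre {a : ℕ} (h : P.sitesPerDir i = P.L ^ a * P.sitesPerDir i') (y : Site P i') :
    (Finset.univ.filter fun x : Site P i => proj i' a x = y).card = (P.L ^ a) ^ P.d := by
  have hc : Fintype.card {x : Site P i // proj i' a x = y} = (P.L ^ a) ^ P.d := by
    rw [Fintype.card_congr (fibreEquiv h y), Fintype.card_fun, Fintype.card_fin, Fintype.card_fin]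
  rw [Fintype.card_subtype] at hc
  exact hc

/-- A function on the torus T^{(i)} invariant under all unit shifts x ↦ x + e_μ is constant (the torus (ℤ/N)^d is
generated by the unit vectors). [folklore] -/
theorem const_of_shift_invariant (f : Site P i → ℝ) (h : ∀ μ x, f (Site.shift x μ) = f x) (x y : Site P i) :
    f x = f y := by
  have ha : ∀ (μ : Fin P.d) (x : Site P i) (k : ℕ),
      f (Function.update x μ (x μ + (k : ZMod (P.sitesPerDir i)))) = f x := by
    intro μ x k
    induction k with
    | zero => rw [Nat.cast_zero, add_zero, Function.update_eq_self]
    | succ k ih =>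
      have e : Function.update x μ (x μ + ((k + 1 : ℕ) : ZMod (P.sitesPerDir i)))
          = Site.shift (Function.update x μ (x μ + (k : ZMod (P.sitesPerDir i)))) μ := by
        unfold Site.shift
        rw [Function.update_idem, Function.update_self, Nat.cast_succ, add_assoc]
      rw [e, h, ih]
  have hb : ∀ (μ : Fin P.d) (x : Site P i) (v : ZMod (P.sitesPerDir i)), f (Function.update x μ v) = f x := by
    intro μ x v
    have := ha μ x (v - x μ).val
    rwa [ZMod.natCast_zmod_val, add_sub_cancel] at this
  have hc : ∀ (s : Finset (Fin P.d)) (x y : Site P i), (∀ μ, μ ∉ s → x μ = y μ) → f x = f y := by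
    intro s
    induction s using Finset.induction_on with
    | empty =>
      intro x y hxy
      rw [show x = y from funext fun μ => hxy μ (by simp)]
    | @insert μ₀ s hμ₀ ih =>
      intro x y hxy
      rw [← hb μ₀ x (y μ₀)]
      apply ih
      intro μ hμ
      by_cases hμμ : μ = μ₀
      · subst hμμ; rw [Function.update_self]
      · rw [Function.update_of_ne hμμ]
        exact hxy μ (by simp [Finset.mem_insert, hμμ, hμ])
  exact hc Finset.univ x y fun μ hμ => absurd (Finset.mem_univ μ) hμ

end Site

namespace B1RG242Torus

variable (P : Params)

/-! ## §2  Levels: the realised scale exponent and the completion beyond the unit lattice -/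

/-- The realised scale exponent of level j: `min j (m + K)`.  For j ≤ m + K (all of Bałaban's levels, B12 p. 256 "until
we reach the unit lattice" and beyond up to the one-block torus T^{(m+K)} with 2 sites per direction) it is j; the
levels j > m + K do not occur in print and are COMPLETED here by identity maps (DIVERGENCE D-pv07.13), because
`B1RG242.Tower.Consistent` quantifies over all j ≥ 1. [folklore] -/
def lvl (j : ℕ) : ℕ := min j (P.m + P.K)

/-- The block exponent of the step j → j + 1: 1 inside Bałaban's range (j + 1 ≤ m + K), 0 in the completion. [folklore] -/
def stepExp (j : ℕ) : ℕ := lvl P (j + 1) - lvl P j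

/-- lvl (j+1) = lvl j + stepExp j. [folklore] -/
theorem lvl_succ (j : ℕ) : lvl P (j + 1) = lvl P j + stepExp P j := by unfold stepExp lvl; omega

/-- In Bałaban's range the realised exponent is j. [folklore] -/
theorem lvl_of_le {j : ℕ} (hj : j ≤ P.m + P.K) : lvl P j = j := by unfold lvl; omega

/-- In Bałaban's range every step averages over blocks of side L. [folklore] -/
theorem stepExp_of_lt {j : ℕ} (hj : j + 1 ≤ P.m + P.K) : stepExp P j = 1 := by unfold stepExp lvl; omega

/-- Beyond the one-block torus the steps are trivial. [folklore] -/
theorem stepExp_of_le {j : ℕ} (hj : P.m + P.K ≤ j) : stepExp P j = 0 := by unfold stepExp lvl; omega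

/-- |T_ε| per direction = L^{lvl j} · |T^{(j)}| per direction. [cite: Balaban1987RG1, (0.1) p.251] -/
theorem sitesPerDir_zero_eq (j : ℕ) : P.sitesPerDir 0 = P.L ^ lvl P j * P.sitesPerDir j := by
  have e : P.m + P.K - 0 = lvl P j + (P.m + P.K - j) := by unfold lvl; omega
  unfold Params.sitesPerDir; rw [e, pow_add]; ring

/-- |T^{(j)}| per direction = L^{stepExp j} · |T^{(j+1)}| per direction. [cite: Balaban1987RG1, (0.1) p.251] -/
theorem sitesPerDir_eq_succ (j : ℕ) : P.sitesPerDir j = P.L ^ stepExp P j * P.sitesPerDir (j + 1) := by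
  have e : P.m + P.K - j = stepExp P j + (P.m + P.K - (j + 1)) := by unfold stepExp lvl; omega
  unfold Params.sitesPerDir; rw [e, pow_add]; ring

/-- The realised spacings: L^{lvl (j+1)}ε = L^{stepExp j} · L^{lvl j}ε. [folklore] -/
theorem spacing_lvl_succ (j : ℕ) :
    P.spacing (lvl P (j + 1)) = (P.L : ℝ) ^ stepExp P j * P.spacing (lvl P j) := by
  rw [lvl_succ]; unfold Params.spacing; rw [pow_add]; ring

/-- The block compositions T_ε → T^{(j)} → T^{(j+1)} and T_ε → T^{(j+1)} agree (B^{j+1}(z) = ⋃_{y∈B(z)} B^j(y)).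
[cite: Balaban1982Higgs1, (2.12) p.609] -/
theorem proj_comp_lvl (j : ℕ) (x : Site P 0) :
    Site.proj (j + 1) (stepExp P j) (Site.proj j (lvl P j) x) = Site.proj (j + 1) (lvl P j + stepExp P j) x :=
  Site.proj_comp (sitesPerDir_zero_eq P j) (sitesPerDir_eq_succ P j) x

/-! ## §3  Averaging and extension matrices for a block map, and their algebra -/

section Generic

variable {i i' i'' : ℕ}

/-- The weighted block-averaging matrix: (avgMat w f)(y) = w · Σ_{x : proj x = y} f(x)  ((2.7)/(2.11) with U = 1 have
w = L^{−d}, L^{−kd}). [cite: Balaban1982Higgs1, (2.11) p.609] -/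
def avgMat (i i' a : ℕ) (w : ℝ) : Matrix (Site P i') (Site P i) ℝ :=
  fun y x => if Site.proj i' a x = y then w else 0

/-- The block-extension matrix: (extMat g)(x) = g(proj x) (piecewise-constant extension; the (1.5)-adjoint of the
averaging, `adjoint_weight`). [cite: Balaban1982Higgs1, (1.5) p.604] -/
def extMat (i i' a : ℕ) : Matrix (Site P i) (Site P i') ℝ :=
  fun x y => if Site.proj i' a x = y then 1 else 0

variable {P}

/-- (Q^* g)(x) = g(y), x ∈ B(y). [folklore] -/
theorem extMat_mulVec (a : ℕ) (ψ : Site P i' → ℝ) (x : Site P i) :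
    (extMat P i i' a *ᵥ ψ) x = ψ (Site.proj i' a x) := by
  simp only [extMat, Matrix.mulVec, dotProduct]
  simp_rw [ite_mul, one_mul, zero_mul]
  rw [Finset.sum_ite_eq, if_pos (Finset.mem_univ _)]

/-- Σ_x φ(x)(Q^*ψ)(x) = Σ_x φ(x)ψ(y(x)). [folklore] -/
theorem dotProduct_extMat_mulVec (a : ℕ) (φ : Site P i → ℝ) (ψ : Site P i' → ℝ) :
    φ ⬝ᵥ (extMat P i i' a *ᵥ ψ) = ∑ x, φ x * ψ (Site.proj i' a x) := by
  simp only [dotProduct, extMat_mulVec]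

/-- (Q f)(y) = w Σ_{x ∈ B(y)} f(x), as a sum over the fine torus with an indicator. [folklore] -/
theorem avgMat_mulVec (a : ℕ) (w : ℝ) (φ : Site P i → ℝ) (y : Site P i') :
    (avgMat P i i' a w *ᵥ φ) y = ∑ x, if Site.proj i' a x = y then w * φ x else 0 := by
  simp only [avgMat, Matrix.mulVec, dotProduct]
  refine Finset.sum_congr rfl fun x _ => ?_
  split_ifs <;> simp

/-- Σ_y (Qφ)(y)θ(y) = w Σ_x φ(x)θ(y(x)). [folklore] -/
theorem avgMat_mulVec_dotProduct (a : ℕ) (w : ℝ) (φ : Site P i → ℝ) (θ : Site P i' → ℝ) :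
    (avgMat P i i' a w *ᵥ φ) ⬝ᵥ θ = w * ∑ x, φ x * θ (Site.proj i' a x) := by
  simp only [dotProduct, avgMat_mulVec, Finset.sum_mul]
  rw [Finset.sum_comm, Finset.mul_sum]
  refine Finset.sum_congr rfl fun x _ => ?_
  simp_rw [ite_mul, zero_mul]
  rw [Finset.sum_ite_eq, if_pos (Finset.mem_univ _)]
  ring

/-- QQ^* = w·L^{ad}·1: averaging a block-constant function returns it (B4 p. 580 "The operator P_k is an orthogonal
projection on a subspace of constant functions"). [cite: Balaban1983RegularityDecay, p.580] -/
theorem avgMat_mul_extMat {a : ℕ} (h : P.sitesPerDir i = P.L ^ a * P.sitesPerDir i') (w : ℝ) :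
    avgMat P i i' a w * extMat P i i' a = (w * (((P.L : ℝ) ^ a) ^ P.d)) • (1 : Matrix (Site P i') (Site P i') ℝ) := by
  ext y y'
  rw [Matrix.mul_apply]
  by_cases hy : y = y'
  · subst hy
    rw [Matrix.smul_apply, Matrix.one_apply_eq, smul_eq_mul, mul_one]
    calc ∑ x, avgMat P i i' a w y x * extMat P i i' a x y
        = ∑ x, (if Site.proj i' a x = y then w else 0) := Finset.sum_congr rfl fun x _ => by
            unfold avgMat extMat; split_ifs <;> simp
      _ = w * (((P.L : ℝ) ^ a) ^ P.d) := by
            rw [Finset.sum_ite, Finset.sum_const_zero, add_zero, Finset.sum_const, Site.card_fibre h, nsmul_eq_mul]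
            push_cast; ring
  · rw [Matrix.smul_apply, Matrix.one_apply_ne hy, smul_zero]
    refine Finset.sum_eq_zero fun x _ => ?_
    unfold avgMat extMat
    split_ifs with h1 h2
    · exact absurd (h1.symm.trans h2) hy
    all_goals simp

/-- Averaging in two stages = averaging once (operator content of (2.12)/(2.14): Q_{k+1} = QQ_k for U = 1).
[cite: Balaban1982Higgs1, (2.14) p.609] -/
theorem avgMat_mul_avgMat {a b : ℕ} (w w' : ℝ)
    (hc : ∀ x : Site P i, Site.proj i'' b (Site.proj i' a x) = Site.proj i'' (a + b) x) :
    avgMat P i' i'' b w' * avgMat P i i' a w = avgMat P i i'' (a + b) (w' * w) := by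
  ext z x
  rw [Matrix.mul_apply]
  calc ∑ y, avgMat P i' i'' b w' z y * avgMat P i i' a w y x
      = ∑ y, (if Site.proj i' a x = y then (if Site.proj i'' b y = z then w' * w else 0) else 0) :=
          Finset.sum_congr rfl fun y _ => by unfold avgMat; split_ifs <;> simp
    _ = if Site.proj i'' b (Site.proj i' a x) = z then w' * w else 0 := by
          rw [Finset.sum_ite_eq, if_pos (Finset.mem_univ _)]
    _ = avgMat P i i'' (a + b) (w' * w) z x := by rw [hc]; rfl

/-- Extension in two stages = extension once (Q^*_{k+1} = Q^*_kQ^*). [cite: Balaban1982Higgs1, (2.14) p.609] -/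
theorem extMat_mul_extMat {a b : ℕ}
    (hc : ∀ x : Site P i, Site.proj i'' b (Site.proj i' a x) = Site.proj i'' (a + b) x) :
    extMat P i i' a * extMat P i' i'' b = extMat P i i'' (a + b) := by
  ext x z
  rw [Matrix.mul_apply]
  calc ∑ y, extMat P i i' a x y * extMat P i' i'' b y z
      = ∑ y, (if Site.proj i' a x = y then (if Site.proj i'' b y = z then (1 : ℝ) else 0) else 0) :=
          Finset.sum_congr rfl fun y _ => by unfold extMat; split_ifs <;> simp
    _ = if Site.proj i'' b (Site.proj i' a x) = z then (1 : ℝ) else 0 := by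
          rw [Finset.sum_ite_eq, if_pos (Finset.mem_univ _)]
    _ = extMat P i i'' (a + b) x z := by rw [hc]; rfl

variable (P)

/-- The weight matrix of the scalar product (1.5) on a lattice of spacing s: ⟨f,g⟩ = Σ_x s^d f(x)g(x) = f ⬝ᵥ (weight s *ᵥ g).
[cite: Balaban1982Higgs1, (1.5) p.604] -/
def weight (i : ℕ) (s : ℝ) : Matrix (Site P i) (Site P i) ℝ := s ^ P.d • (1 : Matrix (Site P i) (Site P i) ℝ)

variable {P}

/-- ⟨f,g⟩ = s^d Σ_x f(x)g(x). [cite: Balaban1982Higgs1, (1.5) p.604] -/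
theorem dotProduct_weight_mulVec (s : ℝ) (f g : Site P i → ℝ) :
    f ⬝ᵥ (weight P i s *ᵥ g) = s ^ P.d * (f ⬝ᵥ g) := by
  rw [weight, Matrix.smul_mulVec, Matrix.one_mulVec, dotProduct_smul, smul_eq_mul]

/-- The (1.5)-scalar product is positive definite (s > 0). [folklore] -/
theorem weight_posDef {s : ℝ} (hs : 0 < s) (u : Site P i → ℝ) (hu : u ≠ 0) : 0 < u ⬝ᵥ (weight P i s *ᵥ u) := by
  rw [dotProduct_weight_mulVec]
  refine mul_pos (pow_pos hs _) (lt_of_le_of_ne (Finset.sum_nonneg fun x _ => mul_self_nonneg (u x)) fun h0 => hu ?_)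
  exact dotProduct_self_eq_zero.mp h0.symm

/-- "The adjoint operators with respect to the scalar product (1.5) can be easily written up" (B1 p. 604): the
(1.5)-adjoint of the weighted averaging `avgMat w` (fine spacing s, coarse spacing s', s'^d·w = s^d) is the
block-constant extension `extMat`. [cite: Balaban1982Higgs1, (1.5) p.604] -/
theorem adjoint_weight {a : ℕ} {s s' w : ℝ} (hw : s' ^ P.d * w = s ^ P.d) (φ : Site P i → ℝ) (ψ : Site P i' → ℝ) :
    φ ⬝ᵥ (weight P i s *ᵥ (extMat P i i' a *ᵥ ψ)) = (avgMat P i i' a w *ᵥ φ) ⬝ᵥ (weight P i' s' *ᵥ ψ) := by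
  rw [dotProduct_weight_mulVec, weight, Matrix.smul_mulVec, Matrix.one_mulVec, dotProduct_smul, smul_eq_mul,
    dotProduct_extMat_mulVec, avgMat_mulVec_dotProduct, ← mul_assoc, hw]

variable (P)

/-- L^{−de}·(L^e)^d = 1: the normalisation of the block averages. [folklore] -/
theorem winv_pow_mul_eq_one (e : ℕ) : (((P.L : ℝ) ^ P.d)⁻¹) ^ e * (((P.L : ℝ) ^ e) ^ P.d) = 1 := by
  rw [inv_pow, ← pow_mul, ← pow_mul, mul_comm P.d e, inv_mul_cancel₀ (pow_ne_zero _ P.cast_L_pos.ne')]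

/-- (L^e s)^d · L^{−de} = s^d: the weights of (1.5) on consecutive lattices versus the averaging normalisation. [folklore] -/
theorem scale_weight (s : ℝ) (e : ℕ) : ((P.L : ℝ) ^ e * s) ^ P.d * ((((P.L : ℝ) ^ P.d)⁻¹) ^ e) = s ^ P.d := by
  have h1 := winv_pow_mul_eq_one P e
  rw [mul_pow, mul_comm (((P.L : ℝ) ^ e) ^ P.d), mul_assoc, mul_comm (((P.L : ℝ) ^ e) ^ P.d), h1, mul_one]

end Generic

/-! ## §4  The lattice Laplacian −Δ^ε + m² = Σ_μ ∂^{ε*}_μ∂^ε_μ + m² on a torus (B1 (1.4), p. 605) -/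

section Laplacian

variable {i : ℕ}

/-- The forward unit shift as a matrix: (shiftMat μ f)(x) = f(x + e_μ). [folklore] -/
def shiftMat (i : ℕ) (μ : Fin P.d) : Matrix (Site P i) (Site P i) ℝ :=
  fun x x' => if x' = Site.shift x μ then 1 else 0

/-- The forward lattice derivative (1.4): (∂^s_μ f)(x) = s^{−1}(f(x + s e_μ) − f(x)) on a torus of spacing s (U = 1).
[cite: Balaban1982Higgs1, (1.4) p.604] -/
def deriv (i : ℕ) (s : ℝ) (μ : Fin P.d) : Matrix (Site P i) (Site P i) ℝ := s⁻¹ • (shiftMat P i μ - 1)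

/-- −Δ^s + m² := m²·1 + Σ_μ (∂^s_μ)ᵀ∂^s_μ (B1 p. 605, after (1.11): "−Δ^ε = ∂^{ε*}∂^ε is the Laplace operator on the
torus T_ε"; for the scalar products (1.5)/(1.21) with the same weight s^d on sites and bonds the adjoint ∂^{s*}_μ is
the transpose — NOT-CERTIFIED (vii)). [cite: Balaban1982Higgs1, (1.11) p.605] -/
def hOp (i : ℕ) (s msq : ℝ) : Matrix (Site P i) (Site P i) ℝ :=
  msq • (1 : Matrix (Site P i) (Site P i) ℝ) + ∑ μ, (deriv P i s μ)ᵀ * deriv P i s μ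

variable {P}

/-- (shiftMat μ f)(x) = f(x + e_μ). [folklore] -/
theorem shiftMat_mulVec (μ : Fin P.d) (f : Site P i → ℝ) (x : Site P i) :
    (shiftMat P i μ *ᵥ f) x = f (Site.shift x μ) := by
  simp only [shiftMat, Matrix.mulVec, dotProduct]
  simp_rw [ite_mul, one_mul, zero_mul]
  rw [Finset.sum_ite_eq', if_pos (Finset.mem_univ _)]

/-- (1.4) verbatim for U = 1: (∂^s_μ f)(x) = s^{−1}(f(x + s e_μ) − f(x)). [cite: Balaban1982Higgs1, (1.4) p.604] -/
theorem deriv_mulVec (s : ℝ) (μ : Fin P.d) (f : Site P i → ℝ) (x : Site P i) :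
    (deriv P i s μ *ᵥ f) x = s⁻¹ * (f (Site.shift x μ) - f x) := by
  simp only [deriv, Matrix.smul_mulVec, Matrix.sub_mulVec, Matrix.one_mulVec, Pi.smul_apply, Pi.sub_apply,
    shiftMat_mulVec, smul_eq_mul]

/-- (−Δ^s + m²)f = m²f + Σ_μ ∂ᵀ_μ(∂_μ f). [cite: Balaban1982Higgs1, (1.11) p.605] -/
theorem hOp_mulVec (s msq : ℝ) (f : Site P i → ℝ) :
    hOp P i s msq *ᵥ f = msq • f + ∑ μ, (deriv P i s μ)ᵀ *ᵥ (deriv P i s μ *ᵥ f) := by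
  simp only [hOp, Matrix.add_mulVec, Matrix.smul_mulVec, Matrix.one_mulVec, Matrix.sum_mulVec, Matrix.mulVec_mulVec]

/-- The quadratic form: Σ_x f(x)((−Δ^s + m²)f)(x) = m² Σ_x f(x)² + Σ_μ Σ_x |(∂_μ f)(x)|² (B1 (1.8) = (1.11), B4 (1.3), with
U = 1, up to the common weight s^d). [cite: Balaban1982Higgs1, (1.8) p.605] -/
theorem form_hOp (s msq : ℝ) (f : Site P i → ℝ) :
    f ⬝ᵥ (hOp P i s msq *ᵥ f) = msq * (f ⬝ᵥ f) + ∑ μ, (deriv P i s μ *ᵥ f) ⬝ᵥ (deriv P i s μ *ᵥ f) := by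
  rw [hOp_mulVec, dotProduct_add, dotProduct_smul, smul_eq_mul, dotProduct_sum]
  congr 1
  refine Finset.sum_congr rfl fun μ _ => ?_
  rw [Matrix.dotProduct_mulVec, Matrix.vecMul_transpose]

/-- −Δ^s + m² is positive semi-definite for m² ≥ 0 (B4 (1.6): "m² ≥ 0"). [cite: Balaban1983RegularityDecay, (1.6) p.572] -/
theorem form_hOp_nonneg (s : ℝ) {msq : ℝ} (hm : 0 ≤ msq) (f : Site P i → ℝ) : 0 ≤ f ⬝ᵥ (hOp P i s msq *ᵥ f) := by
  rw [form_hOp]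
  exact add_nonneg (mul_nonneg hm (Finset.sum_nonneg fun x _ => mul_self_nonneg (f x)))
    (Finset.sum_nonneg fun μ _ => Finset.sum_nonneg fun x _ => mul_self_nonneg _)

/-- THE KERNEL LEMMA (finite-torus content of B1 Prop. 2.3 / "It is so", p. 611, for U = 1): if (−Δ^s + m²)f = 0 with
m² ≥ 0 and some positively-weighted block average of f vanishes, then f = 0.  (Proof: the form gives ∂_μ f = 0 for all
μ, so f is shift-invariant, hence constant on the torus; a block average of a constant c is (w·|block|)·c.) [folklore] -/
theorem eq_zero_of_ker {i' a : ℕ} {s msq w : ℝ} (hs : s ≠ 0) (hm : 0 ≤ msq) (hw : 0 < w) (f : Site P i → ℝ)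
    (hH : hOp P i s msq *ᵥ f = 0) (hQ : avgMat P i i' a w *ᵥ f = 0) : f = 0 := by
  have hform := form_hOp s msq f
  rw [hH, dotProduct_zero] at hform
  have h1 : 0 ≤ msq * (f ⬝ᵥ f) := mul_nonneg hm (Finset.sum_nonneg fun x _ => mul_self_nonneg (f x))
  have h2 : ∀ μ, 0 ≤ (deriv P i s μ *ᵥ f) ⬝ᵥ (deriv P i s μ *ᵥ f) :=
    fun μ => Finset.sum_nonneg fun x _ => mul_self_nonneg _
  have hsum : ∑ μ, (deriv P i s μ *ᵥ f) ⬝ᵥ (deriv P i s μ *ᵥ f) = 0 := by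
    have := Finset.sum_nonneg fun μ (_ : μ ∈ (Finset.univ : Finset (Fin P.d))) => h2 μ
    linarith
  have h3 : ∀ μ, (deriv P i s μ *ᵥ f) ⬝ᵥ (deriv P i s μ *ᵥ f) = 0 := fun μ =>
    (Finset.sum_eq_zero_iff_of_nonneg fun μ _ => h2 μ).mp hsum μ (Finset.mem_univ μ)
  have hshift : ∀ μ x, f (Site.shift x μ) = f x := by
    intro μ x
    have hD : deriv P i s μ *ᵥ f = 0 := dotProduct_self_eq_zero.mp (h3 μ)
    have hx := congrFun hD x
    rw [deriv_mulVec, Pi.zero_apply, mul_eq_zero] at hx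
    rcases hx with hx | hx
    · exact absurd hx (inv_ne_zero hs)
    · exact sub_eq_zero.mp hx
  have hconst : ∀ x, f x = f default := fun x => Site.const_of_shift_invariant f hshift x default
  have hq : (avgMat P i i' a w *ᵥ f) (Site.proj i' a (default : Site P i)) = 0 := by rw [hQ]; rfl
  rw [avgMat_mulVec] at hq
  have hrw : ∀ x : Site P i, (if Site.proj i' a x = Site.proj i' a (default : Site P i) then w * f x else 0)
      = if Site.proj i' a x = Site.proj i' a (default : Site P i) then w * f default else 0 :=
    fun x => by rw [hconst x]
  rw [Finset.sum_congr rfl fun x _ => hrw x, Finset.sum_ite, Finset.sum_const_zero, add_zero, Finset.sum_const,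
    nsmul_eq_mul] at hq
  have hcard :
      0 < (Finset.univ.filter fun x : Site P i => Site.proj i' a x = Site.proj i' a (default : Site P i)).card :=
    Finset.card_pos.mpr ⟨default, Finset.mem_filter.mpr ⟨Finset.mem_univ _, rfl⟩⟩
  have hc0 : f default = 0 := by
    rcases mul_eq_zero.mp hq with h | h
    · exact absurd h (Nat.cast_ne_zero.mpr hcard.ne')
    · rcases mul_eq_zero.mp h with h' | h'
      · exact absurd h' hw.ne'
      · exact h'
  funext x
  rw [hconst x, hc0, Pi.zero_apply]

end Laplacian

/-! ## §5  Bałaban's tower on the tori T^{(j)} (U = 1) as an instance of `B1RG242.Tower` -/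

/-- The fine scalar product (1.5): weight ε^d on T_ε. [cite: Balaban1982Higgs1, (1.5) p.604] -/
def WE : Matrix (Site P 0) (Site P 0) ℝ := weight P 0 P.eps

/-- The scalar product (1.5) on T^{(j)}: weight (L^jε)^d (realised exponent `lvl j`). [cite: Balaban1982Higgs1, (1.5) p.604] -/
def W (j : ℕ) : Matrix (Site P j) (Site P j) ℝ := weight P j (P.spacing (lvl P j))

/-- Q_j of (2.11) with U = 1: (Q_j f)(y) = L^{−jd} Σ_{x ∈ B^j(y)} f(x), T_ε → T^{(j)} (`Qk_mulVec`). [cite: Balaban1982Higgs1, (2.11) p.609] -/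
def Qk (j : ℕ) : Matrix (Site P j) (Site P 0) ℝ := avgMat P 0 j (lvl P j) ((((P.L : ℝ) ^ P.d)⁻¹) ^ lvl P j)

/-- Q^*_j, the (1.5)-adjoint of Q_j: (Q^*_j g)(x) = g(y) for x ∈ B^j(y) (`adjk`). [cite: Balaban1982Higgs1, (1.5) p.604] -/
def Qks (j : ℕ) : Matrix (Site P 0) (Site P j) ℝ := extMat P 0 j (lvl P j)

/-- Q of (2.7) with U = 1 on the L^jε-lattice: (Qφ)(y) = L^{−d} Σ_{x ∈ B(y)} φ(x), T^{(j)} → T^{(j+1)} (`Q_apply`; identity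
in the completion j ≥ m + K). [cite: Balaban1982Higgs1, (2.7) p.608] -/
def Q (j : ℕ) : Matrix (Site P (j + 1)) (Site P j) ℝ :=
  avgMat P j (j + 1) (stepExp P j) ((((P.L : ℝ) ^ P.d)⁻¹) ^ stepExp P j)

/-- Q^*, the (1.5)-adjoint of Q (`adj`). [cite: Balaban1982Higgs1, (1.5) p.604] -/
def Qs (j : ℕ) : Matrix (Site P j) (Site P (j + 1)) ℝ := extMat P j (j + 1) (stepExp P j)

/-- Δ^{(0),ε} = −Δ^ε + m² (2.17) with U = 1 (A = 0, no Ω-restriction: the whole torus T_ε). [cite: Balaban1982Higgs1, (2.17) p.610] -/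
def H (msq : ℝ) : Matrix (Site P 0) (Site P 0) ℝ := hOp P 0 P.eps msq

/-- α_j = a_j(L^jε)^{−2} with a_j the tree's `B1.aSeq a L j` ((2.13)/(2.15)). [cite: Balaban1982Higgs1, (2.20) p.610] -/
def α (a : ℝ) (j : ℕ) : ℝ := B1.aSeq a P.L j * (P.spacing j ^ 2)⁻¹

/-- β_j = a(L^{j+1}ε)^{−2}. [cite: Balaban1982Higgs1, (2.30) p.611] -/
def β (a : ℝ) (j : ℕ) : ℝ := a * (P.spacing (j + 1) ^ 2)⁻¹

/-- BAŁABAN'S TOWER ON THE TORI (U = 1): levels T^{(j)} = `Site P j`, H = −Δ^ε + m², Q_j, Q^*_j, Q, Q^*, α_j, β_j as above.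
[cite: Balaban1982Higgs1, (2.11) p.609, (2.20) p.610, (2.43) p.612] -/
def tower (a msq : ℝ) : B1RG242.Tower ℝ (Site P 0) where
  κ := fun j => Site P j
  instFintype := fun j => (inferInstance : Fintype (Site P j))
  instDecEq := fun j => (inferInstance : DecidableEq (Site P j))
  H := H P msq
  Qk := Qk P
  Qks := Qks P
  Q := Q P
  Qs := Qs P
  α := α P a
  β := β P a

/-! ### The structural tower relations, PROVED for the concrete operators -/

/-- QQ^* = 1 on T^{(j+1)} (B4 p. 580 "P_k is an orthogonal projection"), at every level. [cite: Balaban1983RegularityDecay, p.580] -/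
theorem QQs (j : ℕ) : Q P j * Qs P j = 1 := by
  unfold Q Qs
  rw [avgMat_mul_extMat (sitesPerDir_eq_succ P j), winv_pow_mul_eq_one, one_smul]

/-- Q_jQ^*_j = 1 on T^{(j)}. [cite: Balaban1983RegularityDecay, (1.5) p.572] -/
theorem QkQks (j : ℕ) : Qk P j * Qks P j = 1 := by
  unfold Qk Qks
  rw [avgMat_mul_extMat (sitesPerDir_zero_eq P j), winv_pow_mul_eq_one, one_smul]

/-- Q_{j+1} = QQ_j (operator content of (2.12)/(2.14), U = 1), at every level. [cite: Balaban1982Higgs1, (2.14) p.609] -/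
theorem Qk_succ (j : ℕ) : Qk P (j + 1) = Q P j * Qk P j := by
  unfold Qk Q
  rw [avgMat_mul_avgMat _ _ (proj_comp_lvl P j), lvl_succ, pow_add, mul_comm]

/-- Q^*_{j+1} = Q^*_jQ^*. [cite: Balaban1982Higgs1, (2.14) p.609] -/
theorem Qks_succ (j : ℕ) : Qks P (j + 1) = Qks P j * Qs P j := by
  unfold Qks Qs
  rw [extMat_mul_extMat (proj_comp_lvl P j), lvl_succ]

/-- 1 < L as a real number. [folklore] -/
theorem one_lt_cast_L : (1 : ℝ) < P.L := Nat.one_lt_cast.mpr P.hL.2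

/-- The scalar products (1.5) at level j ≥ 1 (`B1RG242.StepData.ScalarProducts`), PROVED: positivity of ⟨·,·⟩ on T^{(j)},
T^{(j+1)}; ⟨φ,(−Δ^ε + m²)φ⟩ ≥ 0 (m² ≥ 0); Q^*_j resp. Q^* ARE the adjoints of Q_j resp. Q; α_j, β_j > 0 (a > 0).
[cite: Balaban1982Higgs1, (1.5) p.604, (2.15) p.609] -/
theorem scalarProducts {a msq : ℝ} (ha : 0 < a) (hm : 0 ≤ msq) (j : ℕ) (hj : 1 ≤ j) :
    ((tower P a msq).step j).ScalarProducts (WE P) (W P j) (W P (j + 1)) where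
  posK u hu := weight_posDef (P.spacing_pos _) u hu
  posM v hv := weight_posDef (P.spacing_pos _) v hv
  formH φ := by
    show 0 ≤ φ ⬝ᵥ (weight P 0 P.eps *ᵥ (hOp P 0 P.eps msq *ᵥ φ))
    rw [dotProduct_weight_mulVec]
    exact mul_nonneg (pow_pos P.eps_pos _).le (form_hOp_nonneg P.eps hm φ)
  adjk φ ψ := by
    show φ ⬝ᵥ (weight P 0 P.eps *ᵥ (extMat P 0 j (lvl P j) *ᵥ ψ))
      = (avgMat P 0 j (lvl P j) ((((P.L : ℝ) ^ P.d)⁻¹) ^ lvl P j) *ᵥ φ) ⬝ᵥ (weight P j (P.spacing (lvl P j)) *ᵥ ψ)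
    exact adjoint_weight (scale_weight P P.eps (lvl P j)) φ ψ
  adj ψ θ := by
    show ψ ⬝ᵥ (weight P j (P.spacing (lvl P j)) *ᵥ (extMat P j (j + 1) (stepExp P j) *ᵥ θ))
      = (avgMat P j (j + 1) (stepExp P j) ((((P.L : ℝ) ^ P.d)⁻¹) ^ stepExp P j) *ᵥ ψ)
        ⬝ᵥ (weight P (j + 1) (P.spacing (lvl P (j + 1))) *ᵥ θ)
    refine adjoint_weight ?_ ψ θ
    rw [spacing_lvl_succ]
    exact scale_weight P (P.spacing (lvl P j)) (stepExp P j)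
  α_pos := by
    show 0 < B1.aSeq a P.L j * (P.spacing j ^ 2)⁻¹
    exact mul_pos (B1.aSeq_pos ha (one_lt_cast_L P) hj) (inv_pos.mpr (pow_pos (P.spacing_pos j) 2))
  β_pos := by
    show 0 < a * (P.spacing (j + 1) ^ 2)⁻¹
    exact mul_pos ha (inv_pos.mpr (pow_pos (P.spacing_pos (j + 1)) 2))

/-- G^ε_j EXISTS on the torus: −Δ^ε + m² + a_j(L^jε)^{−2}Q^*_jQ_j is invertible for m² ≥ 0, a > 0, j ≥ 1 (kernel lemma:
harmonic + zero block averages ⟹ 0).  This is the U = 1, whole-torus case of the existence half of B1 Prop. 2.3.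
[cite: Balaban1982Higgs1, (2.20) p.610] -/
theorem G_arg {a msq : ℝ} (ha : 0 < a) (hm : 0 ≤ msq) (j : ℕ) (hj : 1 ≤ j) :
    IsUnit (H P msq + α P a j • (Qks P j * Qk P j)) := by
  have E := scalarProducts P ha hm j hj
  rw [← Matrix.mulVec_injective_iff_isUnit]
  refine B1RG242.mulVec_injective_of_ker fun φ h0 => ?_
  obtain ⟨hH, hQ⟩ := B1RG242.ker_add_smul_adj (H := H P msq) (X := Qk P j) (Xs := Qks P j) (WE := WE P) (WK := W P j)
    E.α_pos E.formH E.posK E.adjk h0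
  exact eq_zero_of_ker P.eps_pos.ne' hm (pow_pos (inv_pos.mpr (pow_pos P.cast_L_pos _)) _) φ hH hQ

/-- γ_j = a_{j+1}(L^{j+1}ε)^{−2} = α_{j+1} ((2.13) via `B1RG242.StepData.γ_printed`). [cite: Balaban1982Higgs1, (2.13) p.609] -/
theorem γ_eq {a : ℝ} (msq : ℝ) (ha : 0 < a) (j : ℕ) (hj : 1 ≤ j) : ((tower P a msq).step j).γ = α P a (j + 1) := by
  rw [B1RG242.StepData.γ_printed ((tower P a msq).step j) ha (one_lt_cast_L P) hj (P.spacing_pos j)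
    (show ((tower P a msq).step j).α = B1.aSeq a P.L j * (P.spacing j ^ 2)⁻¹ from rfl)
    (show ((tower P a msq).step j).β = a * ((P.L * P.spacing j) ^ 2)⁻¹ by
      show β P a j = _; rw [β, P.spacing_succ])]
  rw [α, P.spacing_succ]

/-- C^{(j),L^jε} EXISTS on the torus: a(L^{j+1}ε)^{−2}Q^*Q + Δ^{(j),L^jε} is invertible for m² ≥ 0, a > 0, j ≥ 1 — "It is
not clear from the formulas (2.30), (2.31) that the covariances are well defined. It is so" (B1 p. 611), U = 1,
whole torus, via `B1RG242.StepData.isUnit_C_of_next` and `G_arg` one level up. [cite: Balaban1982Higgs1, (2.30) p.611] -/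
theorem C_arg {a msq : ℝ} (ha : 0 < a) (hm : 0 ≤ msq) (j : ℕ) (hj : 1 ≤ j) :
    IsUnit (((tower P a msq).step j).β • ((tower P a msq).step j).P + ((tower P a msq).step j).Δk) := by
  have E := scalarProducts P ha hm j hj
  refine B1RG242.StepData.isUnit_C_of_next E ?_
  have hP : ((tower P a msq).step j).Pk1 = Qks P (j + 1) * Qk P (j + 1) := by
    show (Qks P j * Qs P j) * (Q P j * Qk P j) = _
    rw [← Qk_succ, ← Qks_succ]
  rw [γ_eq P msq ha j hj, hP]
  exact G_arg P ha hm (j + 1) (by omega)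

/-- `B1RG242.Tower.Consistent` HOLDS for Bałaban's concrete tower on the tori (U = 1, m² ≥ 0, a > 0): every hypothesis of
the abstract module — QQ^* = 1, Q_{j+1} = QQ_j, Q^*_{j+1} = Q^*_jQ^*, (2.13), α_j + β_j ≠ 0, existence of G^ε_j and of
C^{(j),L^jε} — is a THEOREM here. [cite: Balaban1982Higgs1, (2.11)–(2.14) p.609, (2.20) p.610, (2.30) p.611] -/
theorem consistent {a msq : ℝ} (ha : 0 < a) (hm : 0 ≤ msq) : (tower P a msq).Consistent where
  QQs j _ := QQs P j
  Qk_succ j _ := Qk_succ P j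
  Qks_succ j _ := Qks_succ P j
  α_succ j hj := by
    show α P a (j + 1) = ((tower P a msq).step j).γ
    exact (γ_eq P msq ha j hj).symm
  αβ_ne j hj := (scalarProducts P ha hm j hj).αβ_ne
  G_arg j hj := G_arg P ha hm j hj
  C_arg j hj := C_arg P ha hm j hj

/-- B1 (2.43) = B4 (2.34) = B5 (1.135) "with □ replaced by the whole torus", for BAŁABAN'S CONCRETE OPERATORS (U = 1) on
the torus T_ε, m² ≥ 0, a > 0, UNCONDITIONALLY:
  G^ε_k = Σ_{j=1}^{k−1} a_j²(L^jε)^{−4} G^ε_jQ^*_jC^{(j),L^jε}Q_jG^ε_j + G^ε_1,  k ≥ 1,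
with G^ε_1 = C^{(0),ε} (`G_one`). [cite: Balaban1982Higgs1, (2.43) p.612; Balaban1983RegularityDecay, (2.34) p.582;
Balaban1984PropagatorsI, (1.135) p.39] -/
theorem display243 {a msq : ℝ} (ha : 0 < a) (hm : 0 ≤ msq) (k : ℕ) (hk : 1 ≤ k) :
    (tower P a msq).G k = (∑ j ∈ Finset.Ico 1 k, (tower P a msq).term j) + (tower P a msq).G 1 :=
  (tower P a msq).display243 (consistent P ha hm) k hk

/-- B4 (2.34) in B4's order, at the unit lattice k = K (L^Kε = 1, `Params.spacing_K`): G_K = C^{(0),ε} + Σ_{j=1}^{K−1} … —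
the display B5 p. 39 invokes "with □ replaced by the whole torus". [cite: Balaban1983RegularityDecay, (2.34) p.582;
Balaban1984PropagatorsI, (1.135) p.39] -/
theorem display234_unit {a msq : ℝ} (ha : 0 < a) (hm : 0 ≤ msq) (hK : 1 ≤ P.K) :
    (tower P a msq).G P.K = (tower P a msq).G 1 + ∑ j ∈ Finset.Ico 1 P.K, (tower P a msq).term j := by
  rw [display243 P ha hm P.K hK, add_comm]

/-! ### The operators ARE the printed ones (dictionary lemmas) -/

variable {P}

/-- (2.11) with U = 1, verbatim: (Q_j f)(y) = L^{−jd} Σ_{x ∈ B^j(y)} f(x), y ∈ T^{(j)}, for Bałaban's levels j ≤ m + K.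
[cite: Balaban1982Higgs1, (2.11) p.609] -/
theorem Qk_mulVec (a msq : ℝ) {j : ℕ} (hj : j ≤ P.m + P.K) (f : Site P 0 → ℝ) (y : Site P j) :
    ((tower P a msq).Qk j *ᵥ f) y
      = (((P.L : ℝ) ^ P.d)⁻¹) ^ j * ∑ x ∈ Finset.univ.filter (fun x : Site P 0 => Site.proj j j x = y), f x := by
  show (avgMat P 0 j (lvl P j) ((((P.L : ℝ) ^ P.d)⁻¹) ^ lvl P j) *ᵥ f) y = _
  rw [avgMat_mulVec, lvl_of_le P hj, Finset.sum_filter, Finset.mul_sum]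
  refine Finset.sum_congr rfl fun x _ => ?_
  split_ifs <;> simp

/-- |B^j(y)| = L^{jd} for y ∈ T^{(j)}, j ≤ m + K (so L^{−jd}Σ_{B^j(y)} is an average). [cite: Balaban1987RG1, (0.3) p.252] -/
theorem card_Bj {j : ℕ} (hj : j ≤ P.m + P.K) (y : Site P j) :
    (Finset.univ.filter fun x : Site P 0 => Site.proj j j x = y).card = (P.L ^ j) ^ P.d := by
  have h := Site.card_fibre (sitesPerDir_zero_eq P j) y
  rwa [lvl_of_le P hj] at h

/-- (Q^*_j g)(x) = g(y), x ∈ B^j(y) (piecewise-constant extension), j ≤ m + K. [cite: Balaban1982Higgs1, (1.5) p.604] -/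
theorem Qks_mulVec (a msq : ℝ) {j : ℕ} (hj : j ≤ P.m + P.K) (g : Site P j → ℝ) (x : Site P 0) :
    ((tower P a msq).Qks j *ᵥ g) x = g (Site.proj j j x) := by
  show (extMat P 0 j (lvl P j) *ᵥ g) x = _
  rw [extMat_mulVec, lvl_of_le P hj]

/-- (2.7) with U = 1, verbatim: the matrix of Q on the L^jε-lattice is L^{−d}·1_{x ∈ B(y)} (`blockOf` of `Setup`), for
Bałaban's steps j + 1 ≤ m + K. [cite: Balaban1982Higgs1, (2.7) p.608] -/
theorem Q_apply (a msq : ℝ) {j : ℕ} (hj : j + 1 ≤ P.m + P.K) (y : Site P (j + 1)) (x : Site P j) :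
    (tower P a msq).Q j y x = if blockOf x = y then ((P.L : ℝ) ^ P.d)⁻¹ else 0 := by
  show avgMat P j (j + 1) (stepExp P j) _ y x = _
  unfold avgMat
  rw [stepExp_of_lt P hj, pow_one, Site.proj_one_eq_blockOf]

/-- (Qφ)(y) = L^{−d} Σ_{x ∈ B(y)} φ(x) with `block` of `Setup`, j + 1 ≤ m + K. [cite: Balaban1982Higgs1, (2.7) p.608] -/
theorem Q_mulVec (a msq : ℝ) {j : ℕ} (hj : j + 1 ≤ P.m + P.K) (φ : Site P j → ℝ) (y : Site P (j + 1)) :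
    ((tower P a msq).Q j *ᵥ φ) y = ((P.L : ℝ) ^ P.d)⁻¹ * ∑ x ∈ block y, φ x := by
  show (avgMat P j (j + 1) (stepExp P j) ((((P.L : ℝ) ^ P.d)⁻¹) ^ stepExp P j) *ᵥ φ) y = _
  rw [avgMat_mulVec, stepExp_of_lt P hj, pow_one, block, Finset.sum_filter, Finset.mul_sum]
  refine Finset.sum_congr rfl fun x _ => ?_
  rw [Site.proj_one_eq_blockOf]
  split_ifs <;> simp

/-- (Q^*ψ)(x) = ψ(y), x ∈ B(y), j + 1 ≤ m + K. [cite: Balaban1982Higgs1, (1.5) p.604] -/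
theorem Qs_mulVec (a msq : ℝ) {j : ℕ} (hj : j + 1 ≤ P.m + P.K) (ψ : Site P (j + 1) → ℝ) (x : Site P j) :
    ((tower P a msq).Qs j *ᵥ ψ) x = ψ (blockOf x) := by
  show (extMat P j (j + 1) (stepExp P j) *ᵥ ψ) x = _
  rw [extMat_mulVec, stepExp_of_lt P hj, Site.proj_one_eq_blockOf]

/-- DISCLOSURE of the completion (DIVERGENCE D-pv07.13): beyond the one-block torus, j ≥ m + K, the step "averaging" Q
is the identity relabelling T^{(j)} ≅ T^{(j+1)} (both have 2 sites per direction) — these levels are not Bałaban's.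
[folklore] -/
theorem Q_apply_of_le (a msq : ℝ) {j : ℕ} (hj : P.m + P.K ≤ j) (y : Site P (j + 1)) (x : Site P j) :
    (tower P a msq).Q j y x = if Site.proj (j + 1) 0 x = y then 1 else 0 := by
  show avgMat P j (j + 1) (stepExp P j) _ y x = _
  unfold avgMat
  rw [stepExp_of_le P hj, pow_zero]

/-- ⟨φ,(−Δ^ε + m²)φ⟩ of (1.5) = Σ_x ε^d m²φ(x)² + Σ_μ Σ_x ε^d |(∂^ε_μφ)(x)|² — B4 (1.3)/B1 (1.8) with U = 1 on T_ε.
[cite: Balaban1983RegularityDecay, (1.3) p.572] -/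
theorem form_H (a msq : ℝ) (φ : Site P 0 → ℝ) :
    φ ⬝ᵥ (WE P *ᵥ ((tower P a msq).H *ᵥ φ))
      = P.eps ^ P.d * (msq * (φ ⬝ᵥ φ) + ∑ μ, (deriv P 0 P.eps μ *ᵥ φ) ⬝ᵥ (deriv P 0 P.eps μ *ᵥ φ)) := by
  show φ ⬝ᵥ (weight P 0 P.eps *ᵥ (hOp P 0 P.eps msq *ᵥ φ)) = _
  rw [dotProduct_weight_mulVec, form_hOp]

/-- G^ε_1 = C^{(0),ε} = (−Δ^ε + m² + a(Lε)^{−2}Q^*_1Q_1)^{−1}: (2.20) at k = 1 with a_1 = a (`B1.aSeq_one`) is (2.30) at k = 0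
with (2.17) (Q_1 = Q, P_1 = P). [cite: Balaban1982Higgs1, (2.20) p.610, (2.30) p.611] -/
theorem G_one (a msq : ℝ) :
    (tower P a msq).G 1 = (H P msq + (a * (P.spacing 1 ^ 2)⁻¹) • (Qks P 1 * Qk P 1))⁻¹ := by
  show (H P msq + α P a 1 • (Qks P 1 * Qk P 1))⁻¹ = _
  rw [α, B1.aSeq_one (one_lt_cast_L P)]

/-- The j-th term with the printed coefficient: α_j² = a_j²(L^jε)^{−4}. [cite: Balaban1982Higgs1, (2.43) p.612] -/
theorem term_eq (a msq : ℝ) (j : ℕ) :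
    (tower P a msq).term j = (B1.aSeq a P.L j ^ 2 * (P.spacing j ^ 4)⁻¹)
      • ((tower P a msq).G j * (tower P a msq).Qks j * (tower P a msq).C j * (tower P a msq).Qk j
          * (tower P a msq).G j) := by
  show (B1.aSeq a P.L j * (P.spacing j ^ 2)⁻¹) ^ 2 • _ = _
  congr 1
  ring

end B1RG242Torus

end

end Literature.MathematicalPhysics.QuantumFieldTheory.Balaban1983to89
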